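import Mathlib.Topology.OpenPartialHomeomorph.Composition
import Mathlib.Analysis.SpecialFunctions.SmoothTransition
import Mathlib.Analysis.InnerProductSpace.Calculus
import HarnessLib

/-!
# Global `C^∞` cut-off and saturation of the Morse radius `Σ|Θ(y)ᵢ|²` of a chart of `ℂ^ι`

Family `hodge`, layer `Literature/Geometry/ComplexAnalytic`. Written by the prover seat `hodge-nonav-prover-Bx` (g14, cell
`hodge-nonav`) as a generic brick of the ODP-ISOTOPY port (memo `PROGRAMME-ODP-ISOTOPY-Bx-g13` §2; Picard–Lefschetz binder of
crux K1-B, stmt-HodgeConjecture-19716): the verbatim generalisation, from `ℂ³ = Fin (1+2) → ℂ` to `ℂ^ι` for any finite `ι`, of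
prover-Ax's `CyclicNodePencilRadiusCutoff` (`PhamBrieskorn.morseRadiusCutoff`) and `CyclicNodePencilRadiusSaturated`
(`PhamBrieskorn.radiusDefect`) — nothing in those two files uses the exponents of the singularity, only the chart `Θ`.
The Morse radius `r(y) = Σᵢ |(Θ y)ᵢ|²` of an open partial homeomorphism `Θ` of `ℂ^ι` (e.g. a holomorphic Morse chart at an
ordinary double point, `HolomorphicMorse.exists_holomorphicMorseChart`, `QuadricPencilShellSubmersion`) is defined and smooth
only on `Θ.source`; the global constructions on the ambient manifold (`Motives/UniversalHypersurfaceRegularLocusChartFunction`,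
the tangent lift `Motives/UniversalHypersurfaceRegularLocusLift`, slabs `Geometry/Manifold/IntegralCurveSlab`) want `C^∞`
functions on all of `ℂ^ι` with compact support in the source:

* §1 `ChartRadius.cutoff Θ R'' R'` — `y ↦ smoothTransition((R' − r(y))/(R' − R''))·r(y)` on `Θ.source`, `0` off it: `= r(y)` where
  `r ≤ R''` (`cutoff_of_le`), `= 0` where `r ≥ R'` or off the source; support in the compact `Θ.symm '' {Σ|zᵢ|² ≤ R'}`
  (`tsupport_cutoff_subset`, when `{Σ|zᵢ|² ≤ R'} ⊆ Θ.target`), `C^∞` (`contDiff_cutoff`), germ `= r` where `r < R''`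
  (`cutoff_eventuallyEq`), vanishing outside a norm ball (`exists_bound_cutoff`);
* §2 `ChartRadius.defect Θ R''' R''` — the DEFECT `κ(y) = (R'' − r(y))·σ(r(y))` (`σ` the smooth step, `1` below `R'''`, `0` above
  `R''`), `0` off the source, so that the SATURATED radius `R'' − κ` is `r` where `r ≤ R'''` and `≥ min R'' r` everywhere
  (`defect_of_le`, `min_le_sub_defect`, `lt_of_sub_defect_lt`), `C^∞` with compact support in the source (`contDiff_defect`,
  `tsupport_defect_subset`), germ (`sub_defect_eventuallyEq`), bound (`exists_bound_defect`);
* `isCompact_sumNormSq_le`, `isCompact_symm_image_sumNormSq_le` — the radius regions are compact.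

Everything is proved; the two definitions are concrete; no named facts. Honest scope: bump-function plumbing; nothing here
says HC or any rung is proved.

## References

* [BrockerJanichIDT1982] T. Bröcker, K. Jänich, Introduction to Differential Topology (1982), §7 (bump functions).
* [Milnor1968] J. Milnor, Singular Points of Complex Hypersurfaces (1968), §5 (the Milnor ball).
-/

noncomputable section

open Set Filter Topology Function
open scoped ContDiff

namespace Literature.Geometry.ComplexAnalytic

namespace ChartRadius

variable {ι : Type} [Fintype ι]

/-! ### §1 The cut-off radius -/

section Cutoff

variable (Θ : OpenPartialHomeomorph (ι → ℂ) (ι → ℂ)) (R'' R' : ℝ)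

open scoped Classical in
/-- **The cut-off Morse radius**: `y ↦ smoothTransition((R' − r(y))/(R' − R'')) · r(y)` on `Θ.source`, `r(y) = Σᵢ |(Θ y)ᵢ|²`, and `0` off it.
[cite: BrockerJanichIDT1982, §7] -/
def cutoff (y : ι → ℂ) : ℝ :=
  if y ∈ Θ.source then
    Real.smoothTransition ((R' - ∑ i, ‖Θ y i‖ ^ 2) / (R' - R'')) * ∑ i, ‖Θ y i‖ ^ 2
  else 0

/-- On the source the cut-off radius is the product formula. [cite: BrockerJanichIDT1982, §7] -/
theorem cutoff_of_mem {y : ι → ℂ} (hy : y ∈ Θ.source) :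
    cutoff Θ R'' R' y = Real.smoothTransition ((R' - ∑ i, ‖Θ y i‖ ^ 2) / (R' - R'')) * ∑ i, ‖Θ y i‖ ^ 2 := by
  classical
  simp [cutoff, hy]

/-- Off the source the cut-off radius vanishes. [cite: BrockerJanichIDT1982, §7] -/
theorem cutoff_of_not_mem {y : ι → ℂ} (hy : y ∉ Θ.source) : cutoff Θ R'' R' y = 0 := by
  classical
  simp [cutoff, hy]

/-- **Where `r ≤ R''` the cut-off radius is the radius** (`R'' < R'`). [cite: BrockerJanichIDT1982, §7] -/
theorem cutoff_of_le (hR : R'' < R') {y : ι → ℂ} (hy : y ∈ Θ.source) (hle : ∑ i, ‖Θ y i‖ ^ 2 ≤ R'') :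
    cutoff Θ R'' R' y = ∑ i, ‖Θ y i‖ ^ 2 := by
  rw [cutoff_of_mem Θ R'' R' hy, Real.smoothTransition.one_of_one_le, one_mul]
  rw [le_div_iff₀ (sub_pos.mpr hR), one_mul]
  linarith

/-- Where `r ≥ R'` (inside the source) the cut-off radius vanishes (`R'' < R'`). [cite: BrockerJanichIDT1982, §7] -/
theorem cutoff_of_ge (hR : R'' < R') {y : ι → ℂ} (hy : y ∈ Θ.source) (hge : R' ≤ ∑ i, ‖Θ y i‖ ^ 2) :
    cutoff Θ R'' R' y = 0 := by
  rw [cutoff_of_mem Θ R'' R' hy, Real.smoothTransition.zero_of_nonpos, zero_mul]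
  exact div_nonpos_of_nonpos_of_nonneg (by linarith) (sub_pos.mpr hR).le

/-- The support of the cut-off radius lies in `Θ⁻¹{Σ|zᵢ|² < R'} ∩ Θ.source` (`R'' < R'`). [cite: BrockerJanichIDT1982, §7] -/
theorem support_cutoff_subset (hR : R'' < R') :
    Function.support (cutoff Θ R'' R') ⊆ Θ.symm '' (Θ.target ∩ {z | ∑ i, ‖z i‖ ^ 2 ≤ R'}) := by
  intro y hy
  rw [Function.mem_support] at hy
  have hys : y ∈ Θ.source := by
    by_contra h
    exact hy (cutoff_of_not_mem Θ R'' R' h)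
  have hlt : ∑ i, ‖Θ y i‖ ^ 2 < R' := by
    by_contra h
    exact hy (cutoff_of_ge Θ R'' R' hR hys (not_lt.mp h))
  exact ⟨Θ y, ⟨Θ.map_source hys, hlt.le⟩, Θ.left_inv hys⟩

/-- The radius region `{z | Σ|zᵢ|² ≤ R'}` is compact (closed and bounded in `ℂ^ι`). [cite: Milnor1968, §5] -/
theorem isCompact_sumNormSq_le (R : ℝ) : IsCompact {z : ι → ℂ | ∑ i, ‖z i‖ ^ 2 ≤ R} := by
  have hcont : Continuous fun z : ι → ℂ => ∑ i, ‖z i‖ ^ 2 := by fun_prop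
  have hclosed : IsClosed {z : ι → ℂ | ∑ i, ‖z i‖ ^ 2 ≤ R} := isClosed_le hcont continuous_const
  refine Metric.isCompact_of_isClosed_isBounded hclosed ?_
  refine (Metric.isBounded_closedBall (x := (0 : ι → ℂ)) (r := Real.sqrt (max R 0))).subset fun z hz => ?_
  rw [Metric.mem_closedBall, dist_zero_right, pi_norm_le_iff_of_nonneg (Real.sqrt_nonneg _)]
  intro i
  have hi : ‖z i‖ ^ 2 ≤ ∑ j, ‖z j‖ ^ 2 := Finset.single_le_sum (fun j _ => sq_nonneg ‖z j‖) (Finset.mem_univ i)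
  have h2 : ‖z i‖ ^ 2 ≤ max R 0 := (hi.trans hz).trans (le_max_left _ _)
  exact Real.le_sqrt_of_sq_le h2

/-- If `{Σ|zᵢ|² ≤ R'} ⊆ Θ.target`, its preimage `Θ.symm '' (…)` is a compact subset of `Θ.source`. [cite: Milnor1968, §5] -/
theorem isCompact_symm_image_sumNormSq_le (hR' : {z : ι → ℂ | ∑ i, ‖z i‖ ^ 2 ≤ R'} ⊆ Θ.target) :
    IsCompact (Θ.symm '' (Θ.target ∩ {z | ∑ i, ‖z i‖ ^ 2 ≤ R'})) ∧
      Θ.symm '' (Θ.target ∩ {z | ∑ i, ‖z i‖ ^ 2 ≤ R'}) ⊆ Θ.source := by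
  have heq : Θ.target ∩ {z : ι → ℂ | ∑ i, ‖z i‖ ^ 2 ≤ R'} = {z | ∑ i, ‖z i‖ ^ 2 ≤ R'} :=
    Set.inter_eq_right.mpr hR'
  refine ⟨?_, ?_⟩
  · rw [heq]
    exact (isCompact_sumNormSq_le R').image_of_continuousOn (Θ.continuousOn_symm.mono hR')
  · rintro _ ⟨z, hz, rfl⟩
    exact Θ.map_target hz.1

/-- **The topological support of the cut-off radius is compact and lies in `Θ.source`** (`R'' < R'`, `{Σ|zᵢ|² ≤ R'} ⊆ Θ.target`).
[cite: BrockerJanichIDT1982, §7] -/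
theorem tsupport_cutoff_subset (hR : R'' < R') (hR' : {z : ι → ℂ | ∑ i, ‖z i‖ ^ 2 ≤ R'} ⊆ Θ.target) :
    tsupport (cutoff Θ R'' R') ⊆ Θ.symm '' (Θ.target ∩ {z | ∑ i, ‖z i‖ ^ 2 ≤ R'}) ∧
      tsupport (cutoff Θ R'' R') ⊆ Θ.source := by
  obtain ⟨hc, hsub⟩ := isCompact_symm_image_sumNormSq_le Θ R' hR'
  have h1 : tsupport (cutoff Θ R'' R') ⊆ Θ.symm '' (Θ.target ∩ {z | ∑ i, ‖z i‖ ^ 2 ≤ R'}) :=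
    closure_minimal (support_cutoff_subset Θ R'' R' hR) hc.isClosed
  exact ⟨h1, h1.trans hsub⟩

/-- **The cut-off radius is `C^∞` on `ℂ^ι`** (`Θ` `C^∞` on its source, `R'' < R'`, `{Σ|zᵢ|² ≤ R'} ⊆ Θ.target`): on the source it is a
product of smooth functions, off its (closed) support it vanishes identically. [cite: BrockerJanichIDT1982, §7] -/
theorem contDiff_cutoff (hΘ : ContDiffOn ℝ ∞ Θ Θ.source) (hR : R'' < R')
    (hR' : {z : ι → ℂ | ∑ i, ‖z i‖ ^ 2 ≤ R'} ⊆ Θ.target) :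
    ContDiff ℝ ∞ (cutoff Θ R'' R') := by
  rw [contDiff_iff_contDiffAt]
  intro y
  by_cases hy : y ∈ tsupport (cutoff Θ R'' R')
  · have hys : y ∈ Θ.source := (tsupport_cutoff_subset Θ R'' R' hR hR').2 hy
    -- the radius `r` is smooth at `y`
    have hr : ContDiffAt ℝ ∞ (fun y : ι → ℂ => ∑ i, ‖Θ y i‖ ^ 2) y := by
      have hΘy : ContDiffAt ℝ ∞ (Θ : (ι → ℂ) → ι → ℂ) y := hΘ.contDiffAt (Θ.open_source.mem_nhds hys)
      refine ContDiffAt.sum fun i _ => ?_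
      have hi : ContDiffAt ℝ ∞ (fun y : ι → ℂ => Θ y i) y :=
        (contDiffAt_apply ℝ ℂ i (Θ y)).comp y hΘy
      exact hi.norm_sq ℝ
    have hprod : ContDiffAt ℝ ∞ (fun y : ι → ℂ =>
        Real.smoothTransition ((R' - ∑ i, ‖Θ y i‖ ^ 2) / (R' - R'')) * ∑ i, ‖Θ y i‖ ^ 2) y :=
      ((Real.smoothTransition.contDiff.contDiffAt).comp y ((contDiffAt_const.sub hr).div_const _)).mul hr
    refine hprod.congr_of_eventuallyEq ?_
    filter_upwards [Θ.open_source.mem_nhds hys] with y' hy'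
    exact cutoff_of_mem Θ R'' R' hy'
  · rw [notMem_tsupport_iff_eventuallyEq] at hy
    exact contDiffAt_const.congr_of_eventuallyEq hy

/-- **Near a point `y₀ ∈ Θ.source` with `r(y₀) < R''` the cut-off radius IS the radius** (as germs). [cite: BrockerJanichIDT1982, §7] -/
theorem cutoff_eventuallyEq (hR : R'' < R') {y₀ : ι → ℂ} (hy₀ : y₀ ∈ Θ.source)
    (hlt : ∑ i, ‖Θ y₀ i‖ ^ 2 < R'') :
    cutoff Θ R'' R' =ᶠ[𝓝 y₀] fun y => ∑ i, ‖Θ y i‖ ^ 2 := by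
  have hcont : ContinuousAt (fun y : ι → ℂ => ∑ i, ‖Θ y i‖ ^ 2) y₀ := by
    have hΘc : ContinuousAt (Θ : (ι → ℂ) → ι → ℂ) y₀ := Θ.continuousAt hy₀
    refine tendsto_finsetSum _ fun i _ => ?_
    exact ((continuous_apply i).continuousAt.comp hΘc).norm.pow 2
  have hlt' : ∀ᶠ y in 𝓝 y₀, ∑ i, ‖Θ y i‖ ^ 2 < R'' := hcont.eventually (gt_mem_nhds hlt)
  filter_upwards [hlt', Θ.open_source.mem_nhds hy₀] with y hy hys
  exact cutoff_of_le Θ R'' R' hR hys hy.le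

/-- **The cut-off radius vanishes outside a norm ball** (its support is compact). [cite: BrockerJanichIDT1982, §7] -/
theorem exists_bound_cutoff (hR : R'' < R') (hR' : {z : ι → ℂ | ∑ i, ‖z i‖ ^ 2 ≤ R'} ⊆ Θ.target) :
    ∃ R : ℝ, ∀ y : ι → ℂ, R < ‖y‖ → cutoff Θ R'' R' y = 0 := by
  obtain ⟨hc, -⟩ := isCompact_symm_image_sumNormSq_le Θ R' hR'
  obtain ⟨R, hRb⟩ := hc.isBounded.subset_closedBall (0 : ι → ℂ)
  refine ⟨R, fun y hy => ?_⟩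
  by_contra hne
  have hmem : y ∈ Θ.symm '' (Θ.target ∩ {z | ∑ i, ‖z i‖ ^ 2 ≤ R'}) :=
    support_cutoff_subset Θ R'' R' hR (Function.mem_support.mpr hne)
  have := hRb hmem
  rw [Metric.mem_closedBall, dist_zero_right] at this
  exact absurd hy (not_lt.mpr this)

end Cutoff

/-! ### §2 The radius defect and the saturated radius -/

section Defect

variable (Θ : OpenPartialHomeomorph (ι → ℂ) (ι → ℂ)) (R''' R'' : ℝ)

open scoped Classical in
/-- **The radius defect** `κ(y) = (R'' − Σ|Θ y|²)·σ(Σ|Θ y|²)` on `Θ.source` (`σ = smoothTransition((R'' − u)/(R'' − R'''))`), `0` off it.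
[cite: BrockerJanichIDT1982, §7] -/
def defect (y : ι → ℂ) : ℝ :=
  if y ∈ Θ.source then
    (R'' - ∑ i, ‖Θ y i‖ ^ 2) * Real.smoothTransition ((R'' - ∑ i, ‖Θ y i‖ ^ 2) / (R'' - R'''))
  else 0

/-- On the source the defect is the product formula. [cite: BrockerJanichIDT1982, §7] -/
theorem defect_of_mem {y : ι → ℂ} (hy : y ∈ Θ.source) :
    defect Θ R''' R'' y =
      (R'' - ∑ i, ‖Θ y i‖ ^ 2) * Real.smoothTransition ((R'' - ∑ i, ‖Θ y i‖ ^ 2) / (R'' - R''')) := by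
  classical
  simp [defect, hy]

/-- Off the source the defect vanishes. [cite: BrockerJanichIDT1982, §7] -/
theorem defect_of_not_mem {y : ι → ℂ} (hy : y ∉ Θ.source) : defect Θ R''' R'' y = 0 := by
  classical
  simp [defect, hy]

/-- **Where `Σ ≤ R'''` the saturated radius `R'' − κ` IS the radius** (`R''' < R''`). [cite: BrockerJanichIDT1982, §7] -/
theorem defect_of_le (hR : R''' < R'') {y : ι → ℂ} (hy : y ∈ Θ.source) (hle : ∑ i, ‖Θ y i‖ ^ 2 ≤ R''') :
    defect Θ R''' R'' y = R'' - ∑ i, ‖Θ y i‖ ^ 2 := by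
  rw [defect_of_mem Θ R''' R'' hy, Real.smoothTransition.one_of_one_le, mul_one]
  rw [le_div_iff₀ (sub_pos.mpr hR), one_mul]
  linarith

/-- Where `Σ ≥ R''` (inside the source) the defect vanishes (`R''' < R''`). [cite: BrockerJanichIDT1982, §7] -/
theorem defect_of_ge (hR : R''' < R'') {y : ι → ℂ} (hy : y ∈ Θ.source) (hge : R'' ≤ ∑ i, ‖Θ y i‖ ^ 2) :
    defect Θ R''' R'' y = 0 := by
  rw [defect_of_mem Θ R''' R'' hy, Real.smoothTransition.zero_of_nonpos, mul_zero]
  exact div_nonpos_of_nonpos_of_nonneg (by linarith) (sub_pos.mpr hR).le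

/-- **The saturated radius dominates the radius on the source**: `R'' − κ(y) ≥ Σ|Θ y|²` when `Σ|Θ y|² ≤ R''`; in general
`R'' − κ(y) ≥ min R'' (Σ|Θ y|²)` on the source. [cite: BrockerJanichIDT1982, §7] -/
theorem min_le_sub_defect (hR : R''' < R'') {y : ι → ℂ} (hy : y ∈ Θ.source) :
    min R'' (∑ i, ‖Θ y i‖ ^ 2) ≤ R'' - defect Θ R''' R'' y := by
  rw [defect_of_mem Θ R''' R'' hy]
  set u := ∑ i, ‖Θ y i‖ ^ 2 with hu
  have h0 := Real.smoothTransition.nonneg ((R'' - u) / (R'' - R'''))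
  have h1 := Real.smoothTransition.le_one ((R'' - u) / (R'' - R'''))
  rcases le_total u R'' with hle | hge
  · rw [min_eq_right hle]
    nlinarith
  · rw [min_eq_left hge]
    have : Real.smoothTransition ((R'' - u) / (R'' - R''')) = 0 :=
      Real.smoothTransition.zero_of_nonpos (div_nonpos_of_nonpos_of_nonneg (by linarith) (sub_pos.mpr hR).le)
    rw [this, mul_zero, sub_zero]

/-- **Small values of the saturated radius detect the inner region**: if `R'' − κ(y) < R'''` (`R''' < R''`) then `y ∈ Θ.source` and
`Σ|Θ y|² = R'' − κ(y)` (`< R'''`). [cite: BrockerJanichIDT1982, §7] -/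
theorem lt_of_sub_defect_lt (hR : R''' < R'') {y : ι → ℂ} (hlt : R'' - defect Θ R''' R'' y < R''') :
    y ∈ Θ.source ∧ ∑ i, ‖Θ y i‖ ^ 2 = R'' - defect Θ R''' R'' y := by
  have hy : y ∈ Θ.source := by
    by_contra h
    rw [defect_of_not_mem Θ R''' R'' h, sub_zero] at hlt
    exact absurd hlt (not_lt.mpr hR.le)
  refine ⟨hy, ?_⟩
  have hmin := min_le_sub_defect Θ R''' R'' hR hy
  have hu : ∑ i, ‖Θ y i‖ ^ 2 ≤ R''' := by
    by_contra h
    have h' : R''' < ∑ i, ‖Θ y i‖ ^ 2 := not_le.mp h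
    have : R''' < min R'' (∑ i, ‖Θ y i‖ ^ 2) := lt_min (hR.trans_le le_rfl) h'
    linarith
  rw [defect_of_le Θ R''' R'' hR hy hu]
  ring

/-- The support of the defect lies in `Θ.symm '' (Θ.target ∩ {Σ|zᵢ|² ≤ R''})` (`R''' < R''`). [cite: BrockerJanichIDT1982, §7] -/
theorem support_defect_subset (hR : R''' < R'') :
    Function.support (defect Θ R''' R'') ⊆ Θ.symm '' (Θ.target ∩ {z | ∑ i, ‖z i‖ ^ 2 ≤ R''}) := by
  intro y hy
  rw [Function.mem_support] at hy
  have hys : y ∈ Θ.source := by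
    by_contra h
    exact hy (defect_of_not_mem Θ R''' R'' h)
  have hlt : ∑ i, ‖Θ y i‖ ^ 2 < R'' := by
    by_contra h
    exact hy (defect_of_ge Θ R''' R'' hR hys (not_lt.mp h))
  exact ⟨Θ y, ⟨Θ.map_source hys, hlt.le⟩, Θ.left_inv hys⟩

/-- **The topological support of the defect is compact and inside `Θ.source`** (`R''' < R''`, `{Σ|zᵢ|² ≤ R''} ⊆ Θ.target`).
[cite: BrockerJanichIDT1982, §7] -/
theorem tsupport_defect_subset (hR : R''' < R'') (hR'' : {z : ι → ℂ | ∑ i, ‖z i‖ ^ 2 ≤ R''} ⊆ Θ.target) :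
    tsupport (defect Θ R''' R'') ⊆ Θ.symm '' (Θ.target ∩ {z | ∑ i, ‖z i‖ ^ 2 ≤ R''}) ∧
      tsupport (defect Θ R''' R'') ⊆ Θ.source := by
  obtain ⟨hc, hsub⟩ := isCompact_symm_image_sumNormSq_le Θ R'' hR''
  have h1 : tsupport (defect Θ R''' R'') ⊆ Θ.symm '' (Θ.target ∩ {z | ∑ i, ‖z i‖ ^ 2 ≤ R''}) :=
    closure_minimal (support_defect_subset Θ R''' R'' hR) hc.isClosed
  exact ⟨h1, h1.trans hsub⟩

/-- **The defect is `C^∞` on `ℂ^ι`.** [cite: BrockerJanichIDT1982, §7] -/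
theorem contDiff_defect (hΘ : ContDiffOn ℝ ∞ Θ Θ.source) (hR : R''' < R'')
    (hR'' : {z : ι → ℂ | ∑ i, ‖z i‖ ^ 2 ≤ R''} ⊆ Θ.target) :
    ContDiff ℝ ∞ (defect Θ R''' R'') := by
  rw [contDiff_iff_contDiffAt]
  intro y
  by_cases hy : y ∈ tsupport (defect Θ R''' R'')
  · have hys : y ∈ Θ.source := (tsupport_defect_subset Θ R''' R'' hR hR'').2 hy
    have hr : ContDiffAt ℝ ∞ (fun y : ι → ℂ => ∑ i, ‖Θ y i‖ ^ 2) y := by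
      have hΘy : ContDiffAt ℝ ∞ (Θ : (ι → ℂ) → ι → ℂ) y := hΘ.contDiffAt (Θ.open_source.mem_nhds hys)
      refine ContDiffAt.sum fun i _ => ?_
      exact ((contDiffAt_apply ℝ ℂ i (Θ y)).comp y hΘy).norm_sq ℝ
    have hprod : ContDiffAt ℝ ∞ (fun y : ι → ℂ =>
        (R'' - ∑ i, ‖Θ y i‖ ^ 2) * Real.smoothTransition ((R'' - ∑ i, ‖Θ y i‖ ^ 2) / (R'' - R'''))) y :=
      (contDiffAt_const.sub hr).mul ((Real.smoothTransition.contDiff.contDiffAt).comp y ((contDiffAt_const.sub hr).div_const _))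
    refine hprod.congr_of_eventuallyEq ?_
    filter_upwards [Θ.open_source.mem_nhds hys] with y' hy'
    exact defect_of_mem Θ R''' R'' hy'
  · rw [notMem_tsupport_iff_eventuallyEq] at hy
    exact contDiffAt_const.congr_of_eventuallyEq hy

/-- **Near a point `y₀ ∈ Θ.source` with `Σ|Θ y₀|² < R'''` the saturated radius is the radius** (as germs):
`R'' − κ =ᶠ Σ|Θ ·|²`. [cite: BrockerJanichIDT1982, §7] -/
theorem sub_defect_eventuallyEq (hR : R''' < R'') {y₀ : ι → ℂ} (hy₀ : y₀ ∈ Θ.source)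
    (hlt : ∑ i, ‖Θ y₀ i‖ ^ 2 < R''') :
    (fun y => R'' - defect Θ R''' R'' y) =ᶠ[𝓝 y₀] fun y => ∑ i, ‖Θ y i‖ ^ 2 := by
  have hcont : ContinuousAt (fun y : ι → ℂ => ∑ i, ‖Θ y i‖ ^ 2) y₀ := by
    have hΘc : ContinuousAt (Θ : (ι → ℂ) → ι → ℂ) y₀ := Θ.continuousAt hy₀
    refine tendsto_finsetSum _ fun i _ => ?_
    exact ((continuous_apply i).continuousAt.comp hΘc).norm.pow 2
  have hlt' : ∀ᶠ y in 𝓝 y₀, ∑ i, ‖Θ y i‖ ^ 2 < R''' := hcont.eventually (gt_mem_nhds hlt)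
  filter_upwards [hlt', Θ.open_source.mem_nhds hy₀] with y hy hys
  rw [defect_of_le Θ R''' R'' hR hys hy.le]
  ring

/-- **The defect vanishes outside a norm ball** (compact support). [cite: BrockerJanichIDT1982, §7] -/
theorem exists_bound_defect (hR : R''' < R'') (hR'' : {z : ι → ℂ | ∑ i, ‖z i‖ ^ 2 ≤ R''} ⊆ Θ.target) :
    ∃ R : ℝ, ∀ y : ι → ℂ, R < ‖y‖ → defect Θ R''' R'' y = 0 := by
  obtain ⟨hc, -⟩ := isCompact_symm_image_sumNormSq_le Θ R'' hR''
  obtain ⟨R, hRb⟩ := hc.isBounded.subset_closedBall (0 : ι → ℂ)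
  refine ⟨R, fun y hy => ?_⟩
  by_contra hne
  have hmem := support_defect_subset Θ R''' R'' hR (Function.mem_support.mpr hne)
  have := hRb hmem
  rw [Metric.mem_closedBall, dist_zero_right] at this
  exact absurd hy (not_lt.mpr this)

end Defect

end ChartRadius

end Literature.Geometry.ComplexAnalytic

end
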